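/-!
# NOT A LINE — placeholder (crux stmt-BirchSwinnertonDyer-0490, strategist s2, 2026-08-17)

This path (`Lines/restate_probe.lean`) was written by mistake under `Lines/`; it is NOT a registered
skeleton (no `stub_*`, no `_of`, never passed to `ledger skeleton check`). The probe it held —
the tenure-kit signatures `PAdicOrderRankClauseAtOnePrime` / `CruxesToThesisV4` elaborating under the
route file's import block, glue proof rc 0 — lives at the crux directory top level as
`RestateProbe0490s2.lean`; see `TENURE-KIT.md` and `STRATEGY-CENSUS.md` § Necessity.
Leads: the only registered line of this crux is `Lines/Sketch.lean`.
-/
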